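import Literature.InformationTheory.Coding.ReedMullerMajorityDecoding
import Literature.InformationTheory.QuantumCodes.QuantumReedMullerCodes
import HarnessLib

/-!
# Reed's majority-logic decoder as the sector decoders of the quantum Reed–Muller codes `QRM(m; a, b)`: explicit
# functions of the syndrome with certified radius `2^b − 1` (bit flips) and `2^a − 1` (phase flips) — the optimal radii

Topic `Literature/InformationTheory/QuantumCodes`, namespace `Literature.InformationTheory.QuantumCodes.QRM` (venture QEC,
LADDER-QEC cell `qec`, PARTITION row 08 «the decoder as a FUNCTION syndrome → correction, corrects every Pauli error of weight
≤ t», item «08.QRM» file 5; rung Q4: an explicit decoder family whose certified radius GROWS with the code). Continues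
`Coding/ReedMullerMajorityDecoding.lean` (`reedDecode`, `reedError`, ★ `reedDecode_eq`: Reed's algorithm returns the codeword
of `ℛ(r,m)` from any corruption of weight `< 2^{m−r−1}` — MacWilliams–Sloane Ch. 13 §6) and `QuantumReedMullerCodes.lean`
(`QRM.code m a b`: `X`-checks the generator matrix of `ℛ(a,m)`, `Z`-checks that of `ℛ(b,m)`; `d_X = 2^{b+1}`, `d_Z = 2^{a+1}`).

Nielsen–Chuang §10.4.2 (p. 450): a CSS code corrects bit flips with the classical decoder of `C₁` and phase flips with that of
`C₂^⊥`. Here `C₁ = ker H^Z = ℛ(b,m)^⊥ = ℛ(m−b−1,m)` and `C₂^⊥ = ker H^X = ℛ(m−a−1,m)` (MacWilliams–Sloane Ch. 13 Thm. 4), both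
Reed–Muller codes, decoded by Reed's algorithm. A syndrome decoder needs a received WORD: the explicit Möbius section
`liftSyndrome` (`s ↦ Σ_S s_S Σ_{R⊆S} δ_{1_R}`, a right inverse of the generator matrix: `genMatrix_mulVec_liftSyndrome`) turns the
syndrome `H e` into a word `y` with `H y = H e`, i.e. `y = c + e` for some codeword `c` of the kernel code, and Reed's
algorithm strips `c`.

* `liftSyndrome r s`, `genMatrix_mulVec_liftSyndrome` (`H · lift(s) = s` — via `sum_powerset_indicator`: `#{R : T ⊆ R ⊆ S}` is
  odd iff `T = S`);
* `QRM.reedDecodeX m b` / `reedDecodeZ m a` : `Decoder (syndrome) (word)` — (definitions; computable in principle);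
  `reedDecodeX_xSyndrome` (route I: on every bit-flip pattern `e` with `2·wt(e)·2^{m−b−1} < 2^m` the decoder returns `e`
  itself), likewise `Z`;
* ★ **`reedDecodeX_correctsUpTo`**: radius `2^b − 1 = ⌊(d_X − 1)/2⌋` on `QRM(m;a,b)`; ★ **`reedDecodeZ_correctsUpTo`**: radius
  `2^a − 1 = ⌊(d_Z − 1)/2⌋`; **`reed_decode_radius_optimal`** (`a + b + 2 ≤ m`): the explicit pair corrects every pattern of weight
  `≤ 2^{min(a,b)} − 1` in both sectors and NO pair of sector decoders does better (`IsCode.le_half_of_correctsUpTo_sectors`);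
  instances `code_64_20_8_reed` (radius `3` both sectors), `code_256_70_16_reed` (radius `7`).

Column words: definitions (the printed algorithm) + proved. HONEST FRAMING: code-capacity, sector-wise (bit flips on the
`Z`-checks, phase flips on the `X`-checks), adversarial radius only; the decoder is specified as a function (finite sums and
majorities), no complexity or implementation claim; nothing probabilistic.

## References

* [MacWilliamsSloane1977] Ch. 13 §6 Thm. 14 and the Reed decoding algorithm (held chunks p0315–p0317); Ch. 13 §3 Thm. 4.
* [NielsenChuang2010] §10.4.2 p. 450 (CSS decoding by the two classical decoders).
* [Gottesman1997] §2.3 (distance `2t+1` corrects `t`; chunk p0014 L3) — optimality of the radius.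
* [Steane1999ReedMuller] (construction of the codes; not held, acq-13110).
-/

namespace Literature.InformationTheory.QuantumCodes

open Finset Matrix Literature.InformationTheory.Coding Literature.InformationTheory.Coding.ReedMuller

namespace QRM

variable {m : ℕ}

/-! ### An explicit right inverse of the generator matrix (Möbius inversion on the subset lattice) -/

/-- A monomial at an indicator point: `v_T(1_R) = [T ⊆ R]`. [cite: MacWilliamsSloane1977, Ch. 13 §3 p. 373 (chunk p0306)] -/
private theorem monomialFun_indicator' (T R : Finset (Fin m)) :
    monomialFun T (indicator R) = if T ⊆ R then 1 else 0 := by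
  unfold monomialFun indicator
  rw [prod_boole]
  rfl

/-- **`#{R : T ⊆ R ⊆ S}` is odd iff `T = S`** (in `𝔽₂`; an interval of positive length in the subset lattice — an affine
subspace of `𝔽₂^S` of positive dimension — has evenly many points): for `T ⊊ S` toggling an element of `S ∖ T` is a
fixed-point-free involution of these `R`; for `T ⊄ S` there are none.
[cite: MacWilliamsSloane1977, Ch. 13 §6 Thm. 14 proof (chunk p0317: "all subspaces (except points) contain an even number of points")] -/
theorem sum_powerset_indicator (T S : Finset (Fin m)) :
    (∑ R ∈ S.powerset, (if T ⊆ R then (1 : ZMod 2) else 0)) = if T = S then 1 else 0 := by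
  classical
  split_ifs with hTS
  · subst hTS
    rw [sum_eq_single_of_mem T (mem_powerset.2 Subset.rfl)]
    · rw [if_pos Subset.rfl]
    · intro R hR hRT
      rw [if_neg (fun h => hRT (Subset.antisymm (mem_powerset.1 hR) h))]
  · by_cases hsub : T ⊆ S
    · obtain ⟨j, hjS, hjT⟩ : ∃ j, j ∈ S ∧ j ∉ T := by
        by_contra hno
        push Not at hno
        exact hTS (Subset.antisymm hsub fun i hi => hno i hi)
      refine sum_involution (fun R _ => if j ∈ R then R.erase j else insert j R) (fun R _ => ?_) (fun R _ _ => ?_)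
        (fun R hR => ?_) (fun R _ => ?_)
      · -- `T ⊆ R ↔ T ⊆ toggle R` (as `j ∉ T`), so the two terms cancel
        have hiff : T ⊆ R ↔ T ⊆ (if j ∈ R then R.erase j else insert j R) := by
          split_ifs with hjR
          · exact ⟨fun h i hi => mem_erase.2 ⟨fun hij => hjT (hij ▸ hi), h hi⟩, fun h i hi => (mem_erase.1 (h hi)).2⟩
          · exact ⟨fun h i hi => mem_insert_of_mem (h hi),
              fun h i hi => (mem_insert.1 (h hi)).resolve_left (fun hij => hjT (hij ▸ hi))⟩
        by_cases hTR : T ⊆ R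
        · rw [if_pos hTR, if_pos (hiff.1 hTR)]; exact CharTwo.add_self_eq_zero _
        · rw [if_neg hTR, if_neg (fun h => hTR (hiff.2 h)), add_zero]
      · split_ifs with hjR
        · exact fun h => (notMem_erase j R) (h.symm ▸ hjR)
        · exact fun h => hjR (h ▸ mem_insert_self j R)
      · rw [mem_powerset] at hR ⊢
        split_ifs with hjR
        · exact (erase_subset j R).trans hR
        · exact insert_subset hjS hR
      · by_cases hjR : j ∈ R
        · rw [if_pos hjR, if_neg (notMem_erase j R), insert_erase hjR]
        · rw [if_neg hjR, if_pos (mem_insert_self j R), erase_insert hjR]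
    · refine sum_eq_zero fun R hR => ?_
      rw [if_neg (fun h => hsub (h.trans (mem_powerset.1 hR)))]

/-- **The Möbius section of the generator matrix of `ℛ(r,m)`**: a syndrome `s` (one bit per monomial of degree `≤ r`) is sent
to the word `Σ_S s_S · Σ_{R ⊆ S} δ_{1_R}` (a sum of point masses at indicator vectors). (definition) [folklore] -/
noncomputable def liftSyndrome (r : ℕ) (s : Mono m r → ZMod 2) : (Fin m → ZMod 2) → ZMod 2 :=
  ∑ S : Mono m r, s S • ∑ R ∈ S.1.powerset, Pi.single (indicator R) (1 : ZMod 2)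

/-- **The section is a right inverse**: `H · liftSyndrome(s) = s` for the generator matrix `H` of `ℛ(r,m)` and EVERY `s`.
[cite: MacWilliamsSloane1977, Ch. 13 §3 p. 373 (chunk p0306: the monomial basis)] -/
theorem genMatrix_mulVec_liftSyndrome (r : ℕ) (s : Mono m r → ZMod 2) : genMatrix m r *ᵥ liftSyndrome r s = s := by
  classical
  funext T
  rw [mulVec]
  change monomialFun T.1 ⬝ᵥ liftSyndrome r s = s T
  unfold liftSyndrome
  rw [dotProduct_sum]
  simp_rw [dotProduct_smul, dotProduct_sum, dotProduct_single, mul_one, monomialFun_indicator', sum_powerset_indicator]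
  rw [sum_eq_single T]
  · rw [if_pos rfl, smul_eq_mul, mul_one]
  · intro S _ hS
    rw [if_neg (fun h => hS (Subtype.ext h.symm)), smul_zero]
  · intro h; exact absurd (mem_univ T) h

/-- A word with the same syndrome as `e` is a codeword of the kernel code plus `e` (`r + s + 1 = m`: `ker H = ℛ(s,m)`).
[cite: MacWilliamsSloane1977, Ch. 13 §3 Thm. 4 (chunks p0308-p0309)] -/
theorem liftSyndrome_add_mem_code {r s : ℕ} (h : r + s + 1 = m) (e : (Fin m → ZMod 2) → ZMod 2) :
    liftSyndrome r (genMatrix m r *ᵥ e) + e ∈ ReedMuller.code s m := by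
  rw [← mulVec_eq_zero_iff h, mulVec_add, genMatrix_mulVec_liftSyndrome]
  funext T
  exact CharTwo.add_self_eq_zero _

/-! ### The sector decoders -/

/-- **The bit-flip decoder of `QRM(m; a, b)`**: lift the `Z`-check syndrome (the generator matrix of `ℛ(b,m)`) to a word and
strip the `ℛ(m−b−1,m)`-codeword by Reed's algorithm; what remains is the error. (definition)
[cite: MacWilliamsSloane1977, Ch. 13 §6 (chunk p0316: the Reed decoding algorithm)] [cite: NielsenChuang2010, §10.4.2 (p. 450: bit flips decoded with the decoder of C₁)] -/
noncomputable def reedDecodeX (m b : ℕ) : Decoder (Mono m b → ZMod 2) ((Fin m → ZMod 2) → ZMod 2) :=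
  fun s => reedError (m - b - 1) (liftSyndrome b s)

/-- **The phase-flip decoder of `QRM(m; a, b)`**: the same on the `X`-check syndrome (the generator matrix of `ℛ(a,m)`),
Reed's algorithm for `ℛ(m−a−1,m)`. (definition)
[cite: MacWilliamsSloane1977, Ch. 13 §6 (chunk p0316)] [cite: NielsenChuang2010, §10.4.2 (p. 450: phase flips decoded with the decoder of C₂^⊥)] -/
noncomputable def reedDecodeZ (m a : ℕ) : Decoder (Mono m a → ZMod 2) ((Fin m → ZMod 2) → ZMod 2) :=
  fun s => reedError (m - a - 1) (liftSyndrome a s)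

/-- **Route I, bit flips**: on every `X`-pattern `e` with `2·wt(e)·2^{m−b−1} < 2^m` the decoder returns `e` itself.
[cite: MacWilliamsSloane1977, Ch. 13 §6 (chunk p0316: "the Reed decoding algorithm … will clearly work for any RM code")] -/
theorem reedDecodeX_xSyndrome {a b : ℕ} (h : a + b < m) {e : (Fin m → ZMod 2) → ZMod 2}
    (he : 2 * (hammingNorm e * 2 ^ (m - b - 1)) < 2 ^ m) : reedDecodeX m b ((code m a b h).xSyndrome e) = e := by
  rw [CSSCode.xSyndrome_apply, code_HZ]
  unfold reedDecodeX
  have hmem := liftSyndrome_add_mem_code (show b + (m - b - 1) + 1 = m by omega) e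
  set y := liftSyndrome b (genMatrix m b *ᵥ e)
  have hy : y = (y + e) + e := by
    rw [add_assoc, show e + e = 0 from funext fun x => CharTwo.add_self_eq_zero _, add_zero]
  rw [hy]
  exact reedError_eq hmem he

/-- **Route I, phase flips**: on every `Z`-pattern `e` with `2·wt(e)·2^{m−a−1} < 2^m` the decoder returns `e` itself.
[cite: MacWilliamsSloane1977, Ch. 13 §6 (chunk p0316)] -/
theorem reedDecodeZ_zSyndrome {a b : ℕ} (h : a + b < m) {e : (Fin m → ZMod 2) → ZMod 2}
    (he : 2 * (hammingNorm e * 2 ^ (m - a - 1)) < 2 ^ m) : reedDecodeZ m a ((code m a b h).zSyndrome e) = e := by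
  rw [CSSCode.zSyndrome, code_HX]
  unfold reedDecodeZ
  have hmem := liftSyndrome_add_mem_code (show a + (m - a - 1) + 1 = m by omega) e
  set y := liftSyndrome a (genMatrix m a *ᵥ e)
  have hy : y = (y + e) + e := by
    rw [add_assoc, show e + e = 0 from funext fun x => CharTwo.add_self_eq_zero _, add_zero]
  rw [hy]
  exact reedError_eq hmem he

/-- The radius arithmetic: `wt ≤ 2^b − 1` gives `2 · wt · 2^{m−b−1} < 2^m` (`b < m`). [folklore] -/
private theorem two_mul_lt_of_le {b w : ℕ} (hb : b < m) (hw : w ≤ 2 ^ b - 1) : 2 * (w * 2 ^ (m - b - 1)) < 2 ^ m := by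
  have h1 : 0 < 2 ^ b := Nat.two_pow_pos b
  have h2 : 2 ^ m = 2 ^ b * (2 * 2 ^ (m - b - 1)) := by
    rw [← pow_succ', ← pow_add]
    congr 1
    omega
  rw [h2]
  have : w < 2 ^ b := by omega
  nlinarith [Nat.two_pow_pos (m - b - 1)]

/-- ★ **The Reed bit-flip decoder corrects every `X`-pattern of weight `≤ 2^b − 1`** on `QRM(m; a, b)` — the optimal
`X`-sector radius `⌊(d_X − 1)/2⌋`, `d_X = 2^{b+1}`.
[cite: MacWilliamsSloane1977, Ch. 13 §6 (chunk p0316)] [cite: NielsenChuang2010, §10.4.2 (p. 450)] -/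
theorem reedDecodeX_correctsUpTo {a b : ℕ} (h : a + b < m) :
    (reedDecodeX m b).CorrectsUpTo (code m a b h).xSyndrome
      ((code m a b h).rowSpX : Set ((Fin m → ZMod 2) → ZMod 2)) hammingNorm (2 ^ b - 1) := by
  intro e he
  show reedDecodeX m b ((code m a b h).xSyndrome e) + e ∈ ((code m a b h).rowSpX : Set ((Fin m → ZMod 2) → ZMod 2))
  rw [reedDecodeX_xSyndrome h (two_mul_lt_of_le (by omega) he)]
  have : e + e = 0 := by funext q; exact CharTwo.add_self_eq_zero _
  rw [this]
  exact (code m a b h).rowSpX.zero_mem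

/-- ★ **The Reed phase-flip decoder corrects every `Z`-pattern of weight `≤ 2^a − 1`** on `QRM(m; a, b)` — the optimal
`Z`-sector radius `⌊(d_Z − 1)/2⌋`, `d_Z = 2^{a+1}`.
[cite: MacWilliamsSloane1977, Ch. 13 §6 (chunk p0316)] [cite: NielsenChuang2010, §10.4.2 (p. 450)] -/
theorem reedDecodeZ_correctsUpTo {a b : ℕ} (h : a + b < m) :
    (reedDecodeZ m a).CorrectsUpTo (code m a b h).zSyndrome
      ((code m a b h).rowSpZ : Set ((Fin m → ZMod 2) → ZMod 2)) hammingNorm (2 ^ a - 1) := by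
  intro e he
  show reedDecodeZ m a ((code m a b h).zSyndrome e) + e ∈ ((code m a b h).rowSpZ : Set ((Fin m → ZMod 2) → ZMod 2))
  rw [reedDecodeZ_zSyndrome h (two_mul_lt_of_le (by omega) he)]
  have : e + e = 0 := by funext q; exact CharTwo.add_self_eq_zero _
  rw [this]
  exact (code m a b h).rowSpZ.zero_mem

/-- `⌊(2^{c+1} − 1)/2⌋ = 2^c − 1`. [folklore] -/
private theorem two_pow_succ_sub_one_div_two' (c : ℕ) : (2 ^ (c + 1) - 1) / 2 = 2 ^ c - 1 := by
  have : 0 < 2 ^ c := Nat.two_pow_pos c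
  rw [pow_succ]
  omega

/-- ★ **The explicit Reed decoders ATTAIN the optimal radius of `QRM(m; a, b)`** (`a + b + 2 ≤ m`): both sectors are corrected
up to weight `2^{min(a,b)} − 1 = ⌊(d−1)/2⌋`, and no pair of sector decoders whatsoever corrects every pattern of weight
`2^{min(a,b)}` in both sectors. [cite: Gottesman1997, §2.3 (chunk p0014 L3: distance 2t+1 corrects t errors)] [cite: MacWilliamsSloane1977, Ch. 13 §6 (chunk p0316)] -/
theorem reed_decode_radius_optimal {a b : ℕ} (h : a + b < m) (h2 : a + b + 2 ≤ m) :
    ((reedDecodeX m b).CorrectsUpTo (code m a b h).xSyndrome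
        ((code m a b h).rowSpX : Set ((Fin m → ZMod 2) → ZMod 2)) hammingNorm (2 ^ min a b - 1) ∧
      (reedDecodeZ m a).CorrectsUpTo (code m a b h).zSyndrome
        ((code m a b h).rowSpZ : Set ((Fin m → ZMod 2) → ZMod 2)) hammingNorm (2 ^ min a b - 1)) ∧
    ∀ (DX : Decoder (Mono m b → ZMod 2) ((Fin m → ZMod 2) → ZMod 2))
      (DZ : Decoder (Mono m a → ZMod 2) ((Fin m → ZMod 2) → ZMod 2)) (t : ℕ),
      DX.CorrectsUpTo (code m a b h).xSyndrome ((code m a b h).rowSpX : Set ((Fin m → ZMod 2) → ZMod 2)) hammingNorm t →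
        DZ.CorrectsUpTo (code m a b h).zSyndrome ((code m a b h).rowSpZ : Set ((Fin m → ZMod 2) → ZMod 2)) hammingNorm t →
          t ≤ 2 ^ min a b - 1 := by
  refine ⟨⟨(reedDecodeX_correctsUpTo h).mono ?_, (reedDecodeZ_correctsUpTo h).mono ?_⟩, fun DX DZ t hX hZ => ?_⟩
  · exact Nat.sub_le_sub_right (Nat.pow_le_pow_right (by norm_num) (min_le_right a b)) 1
  · exact Nat.sub_le_sub_right (Nat.pow_le_pow_right (by norm_num) (min_le_left a b)) 1
  · have := (code_isCode h h2).le_half_of_correctsUpTo_sectors hX hZ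
    rwa [two_pow_succ_sub_one_div_two'] at this

/-- **`[[64, 20, 8]]` (`m = 6`, `a = b = 2`)**: the explicit Reed decoders correct every pattern of up to `3` bit flips and every
pattern of up to `3` phase flips — the optimal radius. [cite: MacWilliamsSloane1977, Ch. 13 §6 (chunk p0316)] -/
theorem code_64_20_8_reed :
    (reedDecodeX 6 2).CorrectsUpTo (code 6 2 2 (by norm_num)).xSyndrome
        ((code 6 2 2 (by norm_num)).rowSpX : Set ((Fin 6 → ZMod 2) → ZMod 2)) hammingNorm 3 ∧
      (reedDecodeZ 6 2).CorrectsUpTo (code 6 2 2 (by norm_num)).zSyndrome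
        ((code 6 2 2 (by norm_num)).rowSpZ : Set ((Fin 6 → ZMod 2) → ZMod 2)) hammingNorm 3 :=
  (reed_decode_radius_optimal (m := 6) (a := 2) (b := 2) (by norm_num) (by norm_num)).1

/-- **`[[256, 70, 16]]` (`m = 8`, `a = b = 3`)**: the explicit Reed decoders correct every pattern of up to `7` bit flips and
every pattern of up to `7` phase flips — the optimal radius. [cite: MacWilliamsSloane1977, Ch. 13 §6 (chunk p0316)] -/
theorem code_256_70_16_reed :
    (reedDecodeX 8 3).CorrectsUpTo (code 8 3 3 (by norm_num)).xSyndrome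
        ((code 8 3 3 (by norm_num)).rowSpX : Set ((Fin 8 → ZMod 2) → ZMod 2)) hammingNorm 7 ∧
      (reedDecodeZ 8 3).CorrectsUpTo (code 8 3 3 (by norm_num)).zSyndrome
        ((code 8 3 3 (by norm_num)).rowSpZ : Set ((Fin 8 → ZMod 2) → ZMod 2)) hammingNorm 7 :=
  (reed_decode_radius_optimal (m := 8) (a := 3) (b := 3) (by norm_num) (by norm_num)).1

end QRM

end Literature.InformationTheory.QuantumCodes
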